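import Literature.Computability.Cryptography.HILLHashedFunction
import HarnessLib

/-!
# HILL's hidden bits: `⟨f'(W,R), Y, W ⊙ Y⟩ ≈_c ⟨f'(W,R), Y, β⟩` for `W ← 𝒯̃` (Håstad–Impagliazzo–Levin–Luby 1999, Lemma 6.1.1 with §6.3, last paragraph)

HILL 1999 (SIAM J. Comput. 28; authors' preprint `galaxy-pdf--8752169249696178760`), §6.1:

> **Lemma 6.1.1** Let `W = ⟨X̃, Ĩ⟩ ∈_𝒰 𝒯`, `R ∈_𝒰 {0,1}^{p(n)}`, `Y ∈_𝒰 {0,1}ⁿ`, and `β ∈_𝒰 {0,1}`. Let `f` be a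
> one-way function. Then `⟨f'(W,R), X̃ ⊙ Y, Y⟩` and `⟨f'(W,R), β, Y⟩` are computationally indistinguishable.

and §6.3, last paragraph (why an approximation `p̃ₙ` of `pₙ = Pr[⟨X, I⟩ ∈ 𝒯]` suffices):

> Suppose that `pₙ ≤ p̃ₙ ≤ pₙ + 1/n` and we do the entire construction with `p̃ₙ` replacing `pₙ`. Enlarge `𝒯` to
> density `p̃ₙ` by making it contain some elements `⟨x, i⟩` with `i = D̃_f(f(x)) + 1`. Lemma 6.1.1 is easily seen
> to remain valid …

This file supplies both, on top of `HILLHashedFunction.lean` (`HILL.g f` = `f'` as a hiding randomized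
function, `HILL.T f c` = `𝒯_c`, `HILL.isHidingOver_g`):

* **the enlarged set `𝒯̃ = HILL.Tt f N`** with `𝒯 ⊆ 𝒯̃ ⊆ 𝒯₁` and `#𝒯̃ = t*(N) · 2^{N − b(N)}` *exactly*, where the
  advice `t*(N) = HILL.tStar f N ≤ 2^{b(N)} ≤ 2N + 2` (so the density `p̃ = t*/2^{b(N)}` is a multiple of `2^{-b(N)}`
  and a PPT machine holding `t*` samples `Bernoulli(p̃)` exactly from `b(N)` coins); `isHidingOver_Tt`: `f'` is
  hiding over `𝒯̃` (`isHidingOver_g` for `𝒯₁` and `IsHidingOver.of_subset`, `#𝒯₁ ≤ 2 #𝒯`);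
* **Lemma 6.1.1 over `𝒯̃`, with `K = ⌊log₂ N⌋` hidden bits** (`isCompIndistinguishable_gl`): the tree's
  Goldreich–Levin theorem for hiding functions (`goldreichLevin_hiding_len_holds`, `d = 1`) gives
  `{g f (w‖r) ‖ σ ‖ GL_K(w, σ)}_{w ← 𝒯̃} ≈_c {g f (w‖r) ‖ σ ‖ U_K}` — HILL's hidden bit `X̃ ⊙ Y` is the case of one
  inner product; the `K`-bit block is what the later files hash (`HILL.atomR` / `HILL.atomI` are these samples,
  `glReal_eq` / `glIdeal_eq`);
* `FP` bricks for the later samplers: `HILL.gPF ⟨1^N, ⟨w, r⟩⟩ = g f (w ‖ r)`, `HILL.glbF ⟨1^N, ⟨w, σ⟩⟩ = GL_K(w, σ)`,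
  `HILL.LgU ⟨1^N, ·⟩ = 1^{Lg N}` (the output length of `g f`, read off a run on the zero seed).

## References

* J. Håstad, R. Impagliazzo, L. A. Levin, M. Luby, SIAM J. Comput. 28 (1999): Lemma 6.1.1; §6.2 eq. (5) (`pₙ`);
  §6.3, last paragraph (enlarging `𝒯` to density `p̃ₙ`); Prop. 4.1.2–4.1.3 (Goldreich–Levin).
* O. Goldreich, L. Levin, STOC 1989; Y. Liu, R. Pass, FOCS 2020, Appendix (GL for hiding functions, as vendored).
-/

namespace Literature.Computability.Cryptography

open Filter Asymptotics _root_.Computability Complexity Finset Polynomial HCProd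

namespace HILL

variable (f : List Bool → List Bool)

/-! ### The layer `i = D̃ + 1` and the enlarged set `𝒯̃` -/

/-- **`#𝒯₁ ≥ #𝒯 + 2^{n(N)}`** (`N ≥ 1`): the inputs `x ‖ ⟨D̃(x) + 1⟩` lie in `𝒯₁ ∖ 𝒯`. [cite: HastadImpagliazzoLevinLuby1999, §6.3 (last paragraph: the elements ⟨x, D̃_f(f(x)) + 1⟩)] -/
theorem card_T_zero_add_le {N : ℕ} (hN1 : 1 ≤ N) : (T f 0 N).card + 2 ^ nLen N ≤ (T f 1 N).card := by
  classical
  -- the layer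
  set layer := (Finset.univ : Finset (List.Vector Bool N)).filter fun w => iOf w.toList = Dtil f (xOf w.toList) + 1 with hlayer
  have hdisj : Disjoint (T f 0 N) layer := by
    rw [Finset.disjoint_left]
    intro w hw hw'
    rw [mem_T] at hw
    rw [hlayer, Finset.mem_filter] at hw'
    omega
  have hsub : T f 0 N ∪ layer ⊆ T f 1 N := by
    intro w hw
    rw [Finset.mem_union, mem_T, hlayer, Finset.mem_filter] at hw
    rw [mem_T]
    rcases hw with hw | hw <;> omega
  -- the layer has at least `2^{n(N)}` elements: `x ↦ x ‖ ⟨D̃(x) + 1⟩`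
  have hlt : ∀ x : List.Vector Bool (nLen N), Dtil f x.toList + 1 < 2 ^ bLen N := fun x => by
    have h1 := Dtil_le f x.toList
    have h2 := lt_two_pow_bLen N
    have h3 := nLen_add_bLen hN1
    have h4 : 1 ≤ bLen N := Nat.succ_pos _
    rw [x.toList_length] at h1
    omega
  have hlen : ∀ x : List.Vector Bool (nLen N), (x.toList ++ Complexity.natBits (bLen N) (Dtil f x.toList + 1)).length = N := fun x => by
    rw [List.length_append, x.toList_length, Complexity.length_natBits, nLen_add_bLen hN1]
  let ι : List.Vector Bool (nLen N) → List.Vector Bool N := fun x => ⟨x.toList ++ Complexity.natBits (bLen N) (Dtil f x.toList + 1), hlen x⟩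
  have hinj : Function.Injective ι := fun x x' h => by
    have h' := congrArg List.Vector.toList h
    exact List.Vector.toList_injective (List.append_inj_left h' (by rw [x.toList_length, x'.toList_length]))
  have hmem : ∀ x, ι x ∈ layer := fun x => by
    rw [hlayer, Finset.mem_filter]
    refine ⟨Finset.mem_univ _, ?_⟩
    have hib : (Complexity.natBits (bLen N) (Dtil f x.toList + 1)).length = ibLen N := by rw [Complexity.length_natBits, ibLen_eq hN1]
    show iOf (x.toList ++ Complexity.natBits (bLen N) (Dtil f x.toList + 1)) = Dtil f (xOf (x.toList ++ Complexity.natBits (bLen N) (Dtil f x.toList + 1))) + 1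
    rw [iOf, iBits_append x.toList_length hib, xOf_append x.toList_length hib, Complexity.bitsToNat_natBits (hlt x)]
  have hcard : 2 ^ nLen N ≤ layer.card :=
    calc 2 ^ nLen N = (Finset.univ : Finset (List.Vector Bool (nLen N))).card := by rw [Finset.card_univ, card_vector, Fintype.card_bool]
      _ = ((Finset.univ : Finset (List.Vector Bool (nLen N))).image ι).card := (Finset.card_image_of_injective _ hinj).symm
      _ ≤ layer.card := Finset.card_le_card fun w hw => by
          obtain ⟨x, _, rfl⟩ := Finset.mem_image.1 hw
          exact hmem x
  calc (T f 0 N).card + 2 ^ nLen N ≤ (T f 0 N).card + layer.card := Nat.add_le_add_left hcard _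
    _ = (T f 0 N ∪ layer).card := (Finset.card_union_of_disjoint hdisj).symm
    _ ≤ (T f 1 N).card := Finset.card_le_card hsub

/-- **The advice** `t*(N)`: the least `t` with `#𝒯 ≤ t · 2^{N − b(N)}`. [cite: HastadImpagliazzoLevinLuby1999, §6.2 eq. (5)–(6) and §6.3 (last paragraph: O(n) values of p̃ₙ)] -/
noncomputable def tStar (N : ℕ) : ℕ := ((T f 0 N).card + (2 ^ (N - bLen N) - 1)) / 2 ^ (N - bLen N)

/-- `#𝒯 ≤ t* · 2^{N − b}` and `t* · 2^{N − b} < #𝒯 + 2^{N − b}`. [folklore] -/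
theorem tStar_spec (N : ℕ) :
    (T f 0 N).card ≤ tStar f N * 2 ^ (N - bLen N) ∧ tStar f N * 2 ^ (N - bLen N) < (T f 0 N).card + 2 ^ (N - bLen N) := by
  have hpos : 0 < 2 ^ (N - bLen N) := Nat.two_pow_pos _
  unfold tStar
  set q := 2 ^ (N - bLen N) with hq
  set a := (T f 0 N).card with ha
  constructor
  · -- ceiling division
    have h := Nat.div_add_mod (a + (q - 1)) q
    have hm := Nat.mod_lt (a + (q - 1)) hpos
    rw [Nat.mul_comm]
    omega
  · have h := Nat.div_mul_le_self (a + (q - 1)) q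
    omega

/-- `t*(N) ≤ 2^{b(N)}` (so `t* ≤ 2N + 2`). [folklore] -/
theorem tStar_le (N : ℕ) : tStar f N ≤ 2 ^ bLen N := by
  have h := (tStar_spec f N).2
  have hT : (T f 0 N).card ≤ 2 ^ N := by
    calc (T f 0 N).card ≤ (Finset.univ : Finset (List.Vector Bool N)).card := Finset.card_le_univ _
      _ = 2 ^ N := by rw [Finset.card_univ, card_vector, Fintype.card_bool]
  rcases Nat.eq_zero_or_pos N with rfl | hN
  · simp [bLen] at h hT ⊢; omega
  · have hb := bLen_le hN
    have hN2 : 2 ^ N = 2 ^ bLen N * 2 ^ (N - bLen N) := by rw [← pow_add, Nat.add_sub_cancel' hb]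
    rw [hN2] at hT
    have hpos : 0 < 2 ^ (N - bLen N) := Nat.two_pow_pos _
    by_contra hlt
    push Not at hlt
    have : (2 ^ bLen N + 1) * 2 ^ (N - bLen N) ≤ tStar f N * 2 ^ (N - bLen N) := Nat.mul_le_mul_right _ hlt
    nlinarith

/-- There is a set between `𝒯` and `𝒯₁` of cardinality exactly `t* · 2^{N − b}`. [cite: HastadImpagliazzoLevinLuby1999, §6.3 (last paragraph: enlarge 𝒯 to density p̃ₙ)] -/
theorem exists_Tt (N : ℕ) : ∃ S : Finset (List.Vector Bool N), T f 0 N ⊆ S ∧ S ⊆ T f 1 N ∧ S.card = tStar f N * 2 ^ (N - bLen N) := by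
  obtain ⟨h1, h2⟩ := tStar_spec f N
  refine Finset.exists_subsuperset_card_eq (T_mono f (Nat.zero_le 1) N) h1 ?_
  rcases Nat.eq_zero_or_pos N with rfl | hN
  · -- level 0: everything is the empty string
    have hle : tStar f 0 * 2 ^ (0 - bLen 0) < (T f 0 0).card + 2 ^ (0 - bLen 0) := h2
    have hT1 : (T f 0 0).card ≤ (T f 1 0).card := Finset.card_le_card (T_mono f (Nat.zero_le 1) 0)
    have hc : (T f 0 0).card ≤ 1 := (Finset.card_le_univ _).trans (by simp [card_vector])
    have hc1 : 1 ≤ (T f 0 0).card := (T_nonempty f 0 0).card_pos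
    simp [bLen] at hle ⊢
    omega
  · have h3 := card_T_zero_add_le f hN
    have hnb : N - bLen N = nLen N := rfl
    rw [hnb] at h2 ⊢
    omega

/-- **The enlarged set `𝒯̃`** (a chosen set with `𝒯 ⊆ 𝒯̃ ⊆ 𝒯₁` and `#𝒯̃ = t*(N) · 2^{N − b(N)}`, i.e. of density
exactly `p̃ = t*/2^{b(N)}`). [cite: HastadImpagliazzoLevinLuby1999, §6.3 (last paragraph)] -/
noncomputable def Tt (N : ℕ) : Finset (List.Vector Bool N) := Classical.choose (exists_Tt f N)

/-- `𝒯 ⊆ 𝒯̃`. [folklore] -/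
theorem T_subset_Tt (N : ℕ) : T f 0 N ⊆ Tt f N := (Classical.choose_spec (exists_Tt f N)).1
/-- `𝒯̃ ⊆ 𝒯₁`. [folklore] -/
theorem Tt_subset_T_one (N : ℕ) : Tt f N ⊆ T f 1 N := (Classical.choose_spec (exists_Tt f N)).2.1
/-- `#𝒯̃ = t* · 2^{N − b}`. [folklore] -/
theorem card_Tt (N : ℕ) : (Tt f N).card = tStar f N * 2 ^ (N - bLen N) := (Classical.choose_spec (exists_Tt f N)).2.2
/-- `𝒯̃` is nonempty. [folklore] -/
theorem Tt_nonempty (N : ℕ) : (Tt f N).Nonempty := (T_nonempty f 0 N).mono (T_subset_Tt f N)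
/-- `1 ≤ t*(N)`. [folklore] -/
theorem one_le_tStar (N : ℕ) : 1 ≤ tStar f N := by
  have h := (Tt_nonempty f N).card_pos
  rw [card_Tt] at h
  rcases Nat.eq_zero_or_pos (tStar f N) with h0 | hp
  · rw [h0, zero_mul] at h; exact absurd h (lt_irrefl _)
  · exact hp

variable {f}

/-- **`f'` is hiding over `𝒯̃`.** [cite: HastadImpagliazzoLevinLuby1999, Lemma 6.1.1 with §6.3 (last paragraph: "Lemma 6.1.1 is easily seen to remain valid")] -/
theorem isHidingOver_Tt (hf : IsOneWay f) (hlp : IsLengthPreserving f) : IsHidingOver (g f) (Tt f) rlen :=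
  (isHidingOver_g hf hlp 1).of_subset 2 (Tt_subset_T_one f) fun N =>
    (card_T_succ_le f 0 N).trans (Nat.mul_le_mul_left 2 (Finset.card_le_card (T_subset_Tt f N)))

/-- **Lemma 6.1.1 over `𝒯̃` (Goldreich–Levin, `K = ⌊log₂ N⌋` bits).** For a length-preserving one-way `f`, the
ensembles `{g f (w‖r) ‖ σ ‖ GL_K(w, σ)}` and `{g f (w‖r) ‖ σ ‖ U_K}` (`w ← 𝒯̃_N`, `r ← U_{rlen N}`,
`σ ← U_{K·N}`) are computationally indistinguishable. [cite: HastadImpagliazzoLevinLuby1999, Lemma 6.1.1 (with Prop. 4.1.2–4.1.3)] -/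
theorem isCompIndistinguishable_gl (hf : IsOneWay f) (hlp : IsLengthPreserving f) :
    IsCompIndistinguishable (glRealEns (g f) (Tt f) rlen 1) (glIdealEns (g f) (Tt f) rlen 1) :=
  goldreichLevin_hiding_len_holds (Tt f) (g f) rlen 1 Lg (hasSeedLength hlp _) (Eventually.of_forall (Tt_nonempty f))
    (isHidingOver_Tt hf hlp)

/-! ### The atoms (one Goldreich–Levin sample of `f'`) -/

variable (f)

/-- **The real atom** `g f (w ‖ r) ‖ σ ‖ GL_K(w, σ)` (`K = ⌊log₂ N⌋`). [cite: HastadImpagliazzoLevinLuby1999, §6.2 (f'(X'_j, I'_j, R'_j), Y'_j, X'_j ⊙ Y'_j)] -/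
noncomputable def atomR (N : ℕ) (w ρ σ : List Bool) : List Bool := g f (w ++ ρ) ++ σ ++ glBits (kL N) N w σ

/-- **The ideal atom** `g f (w ‖ r) ‖ σ ‖ u`. [cite: HastadImpagliazzoLevinLuby1999, Lemma 6.1.1 (⟨f'(W,R), β, Y⟩)] -/
noncomputable def atomI (w ρ rest : List Bool) : List Bool := g f (w ++ ρ) ++ rest

/-- The atom length `La N = Lg N + K·N + K`. [folklore] -/
def La (N : ℕ) : ℕ := Lg N + kL N * N + kL N

variable {f}

/-- The tree's `glReal` on a block seed `w ‖ r ‖ σ` is the real atom. [folklore] -/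
theorem glReal_eq {N : ℕ} {w ρ σ : List Bool} (hw : w.length = N) (hρ : ρ.length = rlen N) (hσ : σ.length = kL N * N) :
    glReal (g f) (rlen N) (kL N) N (w ++ ρ ++ σ) = atomR f N w ρ σ := by
  have hwρ : (w ++ ρ).length = N + rlen N := by rw [List.length_append, hw, hρ]
  rw [glReal, atomR, List.take_left' hwρ, List.drop_left' hwρ, List.take_of_length_le hσ.le, List.append_assoc w ρ σ,
    List.take_left' hw]

/-- The tree's `glIdeal` on a block seed `w ‖ r ‖ rest` is the ideal atom. [folklore] -/
theorem glIdeal_eq {N : ℕ} {w ρ : List Bool} (hw : w.length = N) (hρ : ρ.length = rlen N) (rest : List Bool) :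
    glIdeal (g f) (rlen N) N (w ++ ρ ++ rest) = atomI f w ρ rest := by
  have hwρ : (w ++ ρ).length = N + rlen N := by rw [List.length_append, hw, hρ]
  rw [glIdeal, atomI, List.take_left' hwρ, List.drop_left' hwρ]

/-- Length of the real atom. [folklore] -/
theorem length_atomR (hlp : IsLengthPreserving f) {N : ℕ} {w ρ σ : List Bool} (hw : w.length = N) (hρ : ρ.length = rlen N)
    (hσ : σ.length = kL N * N) : (atomR f N w ρ σ).length = La N := by
  rw [atomR, List.length_append, List.length_append, length_g hlp hw hρ, hσ, length_glBits, La]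

/-- Length of the ideal atom. [folklore] -/
theorem length_atomI (hlp : IsLengthPreserving f) {N : ℕ} {w ρ rest : List Bool} (hw : w.length = N) (hρ : ρ.length = rlen N)
    (hrest : rest.length = kL N * N + kL N) : (atomI f w ρ rest).length = La N := by
  rw [atomI, List.length_append, length_g hlp hw hρ, hrest, La, Nat.add_assoc]

/-! ### `FP` bricks for the samplers -/

section Program

open Complexity.Brick Complexity.Plumb Complexity.OracleCompose

variable (f)

/-- `g f (w ‖ r)` from `⟨1^N, ⟨w, r⟩⟩`. [folklore] -/
noncomputable def gPF : List Bool → List Bool := G2 f ∘ fanoutFn fstF (concatFn ∘ sndF)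

/-- `1^{K}` from `⟨1^N, ·⟩` (`K = ⌊log₂ N⌋`). [folklore] -/
noncomputable def KU : List Bool → List Bool := logFn ∘ fstF

/-- `1^N` from `⟨1^N, ·⟩` (normalised through `onesFn`). [folklore] -/
noncomputable def NoU : List Bool → List Bool := onesFn ∘ fstF

/-- `GL_K(w, σ)` from `⟨1^N, ⟨w, σ⟩⟩` (`K = ⌊log₂ N⌋`). [folklore] -/
noncomputable def glbF : List Bool → List Bool := L53Prog.glFn ∘ fanoutFn (fanoutFn KU NoU) sndF

/-- `1^{N + rlen N}` from `⟨1^N, ·⟩`. [folklore] -/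
noncomputable def seedU : List Bool → List Bool := concatFn ∘ fanoutFn NoU (polyFn R0 ∘ fstF)

/-- `1^{Lg N}` from `⟨1^N, ·⟩`: the length of `g f` on the all-zero seed of level `N`. [folklore] -/
noncomputable def LgU : List Bool → List Bool := onesFn ∘ G2 f ∘ fanoutFn fstF (Kannan.zerosFn ∘ seedU)

variable {f}

/-- `onesFn w = 1^{|w|}`. [folklore] -/
private theorem onesFn_eq_ones'' (w : List Bool) : onesFn w = ones w.length := by
  simp [onesFn, Complexity.unaryEncodeNat_eq_replicate, ones]

/-- `|1ⁿ| = n`. [folklore] -/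
private theorem length_unaryEncodeNat'' (n : ℕ) : (unaryEncodeNat n).length = n := unary_decode_encode_nat n

/-- **`gPF ⟨1^N, ⟨w, r⟩⟩ = g f (w ‖ r)`.** [folklore] -/
theorem gPF_apply {N : ℕ} {w ρ : List Bool} (hw : w.length = N) (hρ : ρ.length = rlen N) :
    gPF f (boolPair (unaryEncodeNat N) (boolPair w ρ)) = g f (w ++ ρ) := by
  rw [gPF, Function.comp_apply, fanoutFn_apply, fstF_boolPair, Function.comp_apply, sndF_boolPair, concatFn_boolPair, G2_apply hw hρ]

/-- `gPF ∈ FP`. [folklore] -/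
theorem gPF_mem_FP (hf : f ∈ FP) : gPF f ∈ FP :=
  comp_mem_FP (G2_mem_FP hf) (fanoutFn_mem_FP fstF_mem_FP (comp_mem_FP concatFn_mem_FP sndF_mem_FP))

/-- `KU ⟨1^N, s⟩ = 1^{K}`. [folklore] -/
theorem KU_apply (N : ℕ) (s : List Bool) : KU (boolPair (unaryEncodeNat N) s) = ones (kL N) := by
  rw [KU, Function.comp_apply, fstF_boolPair, logFn, length_unaryEncodeNat'', kL]

/-- `NoU ⟨1^N, s⟩ = 1^N`. [folklore] -/
theorem NoU_apply (N : ℕ) (s : List Bool) : NoU (boolPair (unaryEncodeNat N) s) = ones N := by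
  rw [NoU, Function.comp_apply, fstF_boolPair, onesFn_eq_ones'', length_unaryEncodeNat'']

/-- **`glbF ⟨1^N, ⟨w, σ⟩⟩ = GL_K(w, σ)`.** [folklore] -/
theorem glbF_apply (N : ℕ) (w σ : List Bool) :
    glbF (boolPair (unaryEncodeNat N) (boolPair w σ)) = glBits (kL N) N w σ := by
  rw [glbF, Function.comp_apply, fanoutFn_apply, fanoutFn_apply, KU_apply, NoU_apply, sndF_boolPair, L53Prog.glFn_boolPair]

/-- `glbF ∈ FP`. [folklore] -/
theorem glbF_mem_FP : glbF ∈ FP :=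
  comp_mem_FP L53Prog.glFn_mem_FP (fanoutFn_mem_FP (fanoutFn_mem_FP (comp_mem_FP logFn_mem_FP fstF_mem_FP)
    (comp_mem_FP onesFn_mem_FP fstF_mem_FP)) sndF_mem_FP)

/-- `seedU ⟨1^N, s⟩ = 1^{N + rlen N}`. [folklore] -/
theorem seedU_apply (N : ℕ) (s : List Bool) : seedU (boolPair (unaryEncodeNat N) s) = ones (N + rlen N) := by
  rw [seedU, Function.comp_apply, fanoutFn_apply, NoU_apply, Function.comp_apply, fstF_boolPair, polyFn_apply, length_unaryEncodeNat'',
    R0_eval, concatFn_boolPair, Com.ones_append]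

/-- `seedU ∈ FP`. [folklore] -/
theorem seedU_mem_FP : seedU ∈ FP :=
  comp_mem_FP concatFn_mem_FP (fanoutFn_mem_FP (comp_mem_FP onesFn_mem_FP fstF_mem_FP) (comp_mem_FP (polyFn_mem_FP _) fstF_mem_FP))

/-- **`LgU ⟨1^N, s⟩ = 1^{Lg N}`** for a length-preserving `f`. [folklore] -/
theorem LgU_apply (hlp : IsLengthPreserving f) (N : ℕ) (s : List Bool) : LgU f (boolPair (unaryEncodeNat N) s) = ones (Lg N) := by
  have hz : List.replicate (N + rlen N) false = List.replicate N false ++ List.replicate (rlen N) false := List.replicate_add ..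
  rw [LgU, Function.comp_apply, Function.comp_apply, fanoutFn_apply, fstF_boolPair, Function.comp_apply, seedU_apply,
    Kannan.zerosFn_apply, ones, List.length_replicate, hz, G2_apply (List.length_replicate ..) (List.length_replicate ..),
    onesFn_eq_ones'', length_g hlp (List.length_replicate ..) (List.length_replicate ..)]

/-- `LgU ∈ FP`. [folklore] -/
theorem LgU_mem_FP (hf : f ∈ FP) : LgU f ∈ FP :=
  comp_mem_FP onesFn_mem_FP (comp_mem_FP (G2_mem_FP hf) (fanoutFn_mem_FP fstF_mem_FP (comp_mem_FP Kannan.zerosFn_mem_FP seedU_mem_FP)))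

end Program

end HILL

end Literature.Computability.Cryptography
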